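import Summits.BirchSwinnertonDyer.BirchSwinnertonDyer.Theorems.TwoAdicConverseLambdaParityMatsunoLaw
import Summits.BirchSwinnertonDyer.BirchSwinnertonDyer.Theorems.TwoAdicConverseLambdaHalfMuDoor
import Literature.NumberTheory.EllipticCurves.IwasawaLeadingTermProofs
import Literature.NumberTheory.EllipticCurves.PAdicBSDInterpolationProofs
import HarnessLib

/-!
# Route `TwoAdicConverse` (rung S3), crux `OrdLambdaHalfAtTwo` (item 19556): the ANALYTIC ANOMALOUS FLOOR at `2` —
# `λ(L₂(E)) ≥ 2` (resp. `≥ 3`) for every curve good ordinary at `2` whose normalised `L`-value is `μ`-integral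

Cell `bsd-2adic` (run/shared/lean/pub/bsd-2adic/), seat `bsd-2adic-conv-1` (GEN 10). THEOREMS ONLY — no named fact, no axiom,
no definition; every input is a tree THEOREM (Mazur–Swinnerton-Dyer interpolation `constantCoeff_padicLFunction_unitRoot`, the
unit-root identity `exists_unit_one_sub_unitRoot_inv` `1 − α⁻¹ = u·#Ẽ(𝔽_p)`, the `2`-adic functional equation with exponent
`exists_exponent_subst_padicLFunction_eq_conductorLevel`, integrality of the `2`-free part `pfree`), so the results
are UNCONDITIONAL.

GEN 8's λ_an census (NOTE-19556-conv1-g8, kit j270276 / j270470, 1 465 + 4 543 stable readings) recorded the law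
**L3 «anomalous floor»: on the corank-`0`, `E[2]`-irreducible habitat `λ_an ≥ 2` at `N ≡ ±1 (mod 8)` and `λ_an ≥ 3` at
`N ≡ ±3 (mod 8)` — NEVER `0` or `1` (209/209, 783/783)**, proved there only on the ALGEBRAIC side (`4 ∣ f_X(0)` from Greenberg
4.1@2, `four_dvd_constantCoeff_charGenerator`; the μ-doors p504126/p507926). This file proves the ANALYTIC side as a theorem.
For `W/ℚ` globally minimal, good ordinary at `2`, `f` its newform, `α = unitRoot W 2`, `L = L₂(f,α)` and ANY nonzero `L₀ ∈ Λ =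
ℤ₂⟦T⟧` with `ι L₀ = c·L` (`c ∈ ℚ₂`; the shape of item 19556's per-curve predicate `LambdaHalfAtTwo W`):

* §1 (power-series algebra over `ℚ₂`) the functional equation `g(T^ι) = σ(1+T)^s g(T)` read at ORDER ONE: `σ = −1 ⟹ g(0) = 0`
  (`constantCoeff_eq_zero_of_subst_invOnePlusSubOne_eq_neg`); `σ = +1 ⟹ 2·[T¹]g = −s·[T⁰]g`
  (`two_mul_coeff_one_eq_neg_of_subst_invOnePlusSubOne_eq`) — so `‖[T¹]g‖ ≤ 2‖[T⁰]g‖`.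
* §2 (the curve) **`2` is anomalous at EVERY good ordinary curve**: `‖[T⁰](c·L)‖ = ‖c·[0]⁺_f‖·‖#Ẽ(𝔽₂)‖²` with `‖#Ẽ(𝔽₂)‖ ≤ ½`
  (`norm_constantCoeff_C_mul_padicLFunction_two`, `norm_constantCoeff_C_mul_padicLFunction_two_le`): the constant term carries (at least) TWO extra powers of `2`
  (`#Ẽ(𝔽₂) = 3 − a₂ ∈ {2, 4}`; Mazur 1972 §7, BMS 2016 after Thm 1.7); at root number `+1` the first-order coefficient inherits one
  of them (`norm_coeff_one_le_two_mul_norm_constantCoeff_two`); at root number `−1`, `[T⁰](c·L) = 0`.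
* §3 (λ) write `L₀ = 2^μ P`, `P = pfree L₀`; `λ(L₀)` is the index of the first unit coefficient of `P` and `ι P = 2^{−μ}c·L`. Hence
  **`λ(L₀) ≤ 1 ∧ w = +1 ⟹ ½ ≤ 2^{μ(L₀)}·‖c·[0]⁺_f‖·‖#Ẽ(𝔽₂)‖²`** (`half_le_of_lam_le_one_of_rootNumber_eq_one`), i.e. a small λ forces the
  WHOLE series to be more `2`-divisible than its own normalised `L`-value: **`‖c·[0]⁺_f‖ ≤ 2^{−μ(L₀)}` (`v₂(c·L(E,1)/Ω⁺_f) ≥ μ(L₀)`)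
  `⟹ λ(L₀) ≥ 2`** (`two_le_lam_of_rootNumber_eq_one_of_norm_le`); `w = +1 ∧ [0]⁺_f = 0 ⟹ λ(L₀) ≥ 2`; `w = −1 ⟹ λ(L₀) ≥ 1`.
  The hypothesis is scale-free in `(c, L₀)` and holds in particular when `μ(L₀) = 0` and `c·[0]⁺_f ∈ ℤ₂`
  (`two_le_lam_of_mu_eq_zero_of_norm_le_one`): «`μ_an = 0` and a `2`-integral normalised `L`-value give `λ_an ≥ 2`».
  READING of law L3: its `+2·[r = 0 ∧ t₂ = 0]` term IS this theorem — with rational `2`-torsion the normalised `L`-value acquires a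
  denominator `2^{t}` relative to `2^μ` and the floor drops, exactly as the census shows (λ_an ∈ {0, 1} occurs only at `t₂ > 0`).
  The PARITY(2) upgrades (`λ ≥ 3` at `N ≡ ±3 (mod 8)`, `λ ≥ 2` at root number `−1` and `N ≡ ±1`) and the NECESSARY CONDITION the
  crux imposes (item 19556's predicate `LambdaHalfAtTwo W` forces `λ(X(E/ℚ_∞)) ≥ 2`, resp. `≥ 3`, on this habitat) are in the
  companion file `Theorems/TwoAdicConverseLambdaAnomalousFloorParity.lean`.

HONEST FRAMING. Lower bounds on the ANALYTIC λ: the wrong direction for the crux (which wants `λ_an ≤ λ_alg`); structure and a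
necessary condition, not progress on the ∀-crux — item 19556 ⟺ Kato's main conjecture at `p = 2` away from `(2)`
(`ordLambdaHalfAtTwo_iff_forall_katoMainConjectureAwayFromTwo`) stays OPEN class-wide; BSD is not proved by any of this.
PARTITION (D-0054): none — RANK axis (S3); companion formula cell X5@2 good-ord (B1·O1; 611 book230 classes), owner bsd-2adic.

References: B. Mazur, Invent. Math. 18 (1972), §7 (anomalous primes) [Mazur1972]; B. Mazur, J. Tate, J. Teitelbaum, Invent. Math.
84 (1986), §I.14 (14.3), §I.17 [MazurTateTeitelbaum1986Invent]; R. Greenberg, LNM 1716 (1999), §1 pp. 67–68 (functional equation,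
`⟨N_E⟩`), §5 p. 181 (the fixed point `a = −2` at `p = 2`) [GreenbergLNM1716]; J. Balakrishnan, J. S. Müller, W. Stein, Math. Comp.
85 (2016), remark after Thm. 1.7 (`ord_p ε_p = 2 ord_p N_p`) [BalakrishnanMullerStein2015]; L. Washington, GTM 83, §7.1
[Washington1997]; K. Matsuno, Int. J. Number Theory 4 (2008), Prop. 6.4 (p. 419) [Matsuno2008].
-/

set_option linter.dupNamespace false
set_option autoImplicit false

noncomputable section

open scoped Classical MatrixGroups ModularForm
open CongruenceSubgroup WeierstrassCurve PowerSeries Literature.NumberTheory.EllipticCurves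
  Literature.NumberTheory.EllipticCurves.ModularForms
  Literature.Barriers.BirchSwinnertonDyer
  Summit.BirchSwinnertonDyer.Rank1Residual.X1.MuLambda

namespace Summit.BirchSwinnertonDyer.BirchSwinnertonDyer.Theorems.TwoAdicTwistConverse

/-! ## §1 The functional equation at order one (power series over `ℚ₂`) -/

section OrderOne

/-- `‖2‖₂ = ½`. [folklore] -/
private theorem anomalousFloor_norm_two : ‖(2 : ℚ_[2])‖ = (2 : ℝ)⁻¹ := by
  have h := Padic.norm_p (p := 2)
  simpa using h

/-- `‖(2^μ)⁻¹‖₂ = 2^μ`. [folklore] -/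
private theorem anomalousFloor_norm_inv_two_pow (μ : ℕ) : ‖((2 : ℚ_[2]) ^ μ)⁻¹‖ = (2 : ℝ) ^ μ := by
  rw [norm_inv, norm_pow, anomalousFloor_norm_two, inv_pow, inv_inv]

/-- **Root number `−1` kills the constant term**: if `g(T^ι) = −(1+T)^s·g(T)` in `ℚ₂⟦T⟧` (`T^ι = (1+T)⁻¹ − 1`), then
`g(0) = 0` — compare constant terms: `g(0) = −g(0)`. [cite: GreenbergLNM1716, §1 (functional equation, pp. 67–68)] -/
theorem constantCoeff_eq_zero_of_subst_invOnePlusSubOne_eq_neg {g : ℚ_[2]⟦X⟧} {s : ℤ_[2]}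
    (hFE : g.subst (invOnePlusSubOne : ℚ_[2]⟦X⟧) = C (-1 : ℚ_[2]) * binomialSeries ℚ_[2] s * g) :
    constantCoeff g = 0 := by
  have h0 : constantCoeff (g.subst (invOnePlusSubOne : ℚ_[2]⟦X⟧)) = constantCoeff g :=
    constantCoeff_subst_of_constantCoeff_eq_zero constantCoeff_invOnePlusSubOne g
  have hB : constantCoeff (binomialSeries ℚ_[2] s) = 1 := by
    rw [← coeff_zero_eq_constantCoeff_apply, binomialSeries_coeff, Ring.choose_zero_right, one_smul]
  rw [hFE, map_mul, map_mul, constantCoeff_C, hB, mul_one] at h0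
  have : (2 : ℚ_[2]) * constantCoeff g = 0 := by linear_combination -h0
  simpa using this

/-- **The functional equation at order one, root number `+1`**: if `g(T^ι) = (1+T)^s·g(T)` in `ℚ₂⟦T⟧`, then
`2·[T¹]g = −s·[T⁰]g` — compare the coefficients of `T¹`: `[T¹](g(T^ι)) = −[T¹]g` (`ι = −T + T² − ⋯`), while
`[T¹]((1+T)^s g) = [T¹]g + s·[T⁰]g`. (Greenberg p. 181: at `p = 2` the involution `ι` has the second fixed point `a = −2`;
this is the first-order formal shadow.) [cite: GreenbergLNM1716, §1 (pp. 67–68) and §5 p. 181] -/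
theorem two_mul_coeff_one_eq_neg_of_subst_invOnePlusSubOne_eq {g : ℚ_[2]⟦X⟧} {s : ℤ_[2]}
    (hFE : g.subst (invOnePlusSubOne : ℚ_[2]⟦X⟧) = C (1 : ℚ_[2]) * binomialSeries ℚ_[2] s * g) :
    (2 : ℚ_[2]) * coeff 1 g = -(s : ℚ_[2]) * constantCoeff g := by
  have hι0 := constantCoeff_invOnePlusSubOne (R := ℚ_[2])
  -- left-hand side: `[T¹](g ∘ ι) = −g₁`
  have hA : coeff 1 (g.subst (invOnePlusSubOne : ℚ_[2]⟦X⟧)) = -coeff 1 g := by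
    rw [coeff_subst' (HasSubst.of_constantCoeff_zero' hι0),
      finsum_eq_sum_of_support_subset _ (s := Finset.range 2) ?_]
    · simp only [smul_eq_mul]
      rw [Finset.sum_range_succ, Finset.sum_range_succ, Finset.sum_range_zero, zero_add, pow_zero, coeff_one,
        if_neg one_ne_zero, mul_zero, zero_add, pow_one, coeff_one_invOnePlusSubOne, mul_neg, mul_one]
    · intro d hd
      simp only [Function.mem_support, ne_eq, Finset.coe_range, Set.mem_Iio] at hd ⊢
      by_contra hlt
      apply hd
      rw [coeff_of_lt_order 1 (lt_of_lt_of_le (by exact_mod_cast (by omega : 1 < d))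
        (natCast_le_order_pow hι0 d)), smul_zero]
  -- right-hand side: `[T¹]((1+T)^s g) = g₁ + s g₀`
  have hB : coeff 1 (C (1 : ℚ_[2]) * binomialSeries ℚ_[2] s * g) =
      coeff 1 g + (s : ℚ_[2]) * constantCoeff g := by
    rw [map_one, one_mul, coeff_mul, Finset.Nat.sum_antidiagonal_eq_sum_range_succ_mk, Finset.sum_range_succ,
      Finset.sum_range_succ, Finset.sum_range_zero, zero_add]
    simp only [binomialSeries_coeff, Ring.choose_zero_right, Ring.choose_one_right, one_smul, Nat.sub_zero,
      Nat.sub_self, one_mul, coeff_zero_eq_constantCoeff_apply]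
    rw [Algebra.smul_def, mul_one, PadicInt.algebraMap_apply]
  have hAB : coeff 1 (g.subst (invOnePlusSubOne : ℚ_[2]⟦X⟧)) = coeff 1 (C (1 : ℚ_[2]) * binomialSeries ℚ_[2] s * g) := by
    rw [hFE]
  rw [hA, hB] at hAB
  linear_combination -hAB

/-- Corollary in norms: root number `+1` ⟹ `‖[T¹]g‖₂ = 2·‖s‖·‖[T⁰]g‖ ≤ 2·‖[T⁰]g‖`. [cite: GreenbergLNM1716, §1 (pp. 67–68)] -/
theorem norm_coeff_one_le_of_subst_invOnePlusSubOne_eq {g : ℚ_[2]⟦X⟧} {s : ℤ_[2]}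
    (hFE : g.subst (invOnePlusSubOne : ℚ_[2]⟦X⟧) = C (1 : ℚ_[2]) * binomialSeries ℚ_[2] s * g) :
    ‖coeff 1 g‖ ≤ 2 * ‖constantCoeff g‖ := by
  have h := two_mul_coeff_one_eq_neg_of_subst_invOnePlusSubOne_eq hFE
  have hn : ‖(2 : ℚ_[2]) * coeff 1 g‖ = ‖-(s : ℚ_[2]) * constantCoeff g‖ := by rw [h]
  rw [norm_mul, norm_mul, norm_neg, anomalousFloor_norm_two] at hn
  have hs : ‖(s : ℚ_[2])‖ ≤ 1 := PadicInt.norm_le_one s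
  have h0 : 0 ≤ ‖constantCoeff g‖ := norm_nonneg _
  nlinarith

end OrderOne

/-! ## §2 The curve: `2` is anomalous at every good ordinary `2` -/

section Curve

variable {W : WeierstrassCurve ℚ} [W.IsElliptic] [W.IsGloballyMinimal]

omit [W.IsElliptic] in
/-- `‖#Ẽ(𝔽₂)‖₂ ≤ ½` at a good ordinary `2` (`#Ẽ(𝔽₂) = 3 − a₂` is even: `two_dvd_reductionPointCount_two`). [cite: Mazur1972, §7] -/
theorem norm_reductionPointCount_two_le_half (hord : IsOrdinaryAt W 2) :
    ‖((W.reductionPointCount 2 : ℕ) : ℚ_[2])‖ ≤ 2⁻¹ := by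
  obtain ⟨k, hk⟩ := two_dvd_reductionPointCount_two W hord
  rw [hk, Nat.cast_mul, norm_mul, Nat.cast_ofNat, anomalousFloor_norm_two]
  have hk1 : ‖((k : ℕ) : ℚ_[2])‖ ≤ 1 := by
    simpa using Padic.norm_int_le_one (p := 2) (k : ℤ)
  calc (2 : ℝ)⁻¹ * ‖((k : ℕ) : ℚ_[2])‖ ≤ 2⁻¹ * 1 := mul_le_mul_of_nonneg_left hk1 (by norm_num)
    _ = 2⁻¹ := mul_one _

/-- **The constant term of `c·L₂(f,α)` carries `#Ẽ(𝔽₂)²`**: for `W` good ordinary at `2`, `f` a newform of `W` (any level), `c ∈ ℚ₂`: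
`‖[T⁰](c·L₂(f,α))‖ = ‖c·[0]⁺_f‖·‖#Ẽ(𝔽₂)‖²`, from `L₂(f,α)(0) = (1 − α⁻¹)²[0]⁺_f` (Mazur–Swinnerton-Dyer) and `1 − α⁻¹ = u·#Ẽ(𝔽₂)`,
`u ∈ ℤ₂ˣ` (BMS: `ord ε_p = 2 ord N_p`). [cite: MazurTateTeitelbaum1986Invent, §I.14 (14.3)]
[cite: BalakrishnanMullerStein2015, Thm. 1.7 (remark following)] -/
theorem norm_constantCoeff_C_mul_padicLFunction_two (hord : IsOrdinaryAt W 2) {N : ℕ} [NeZero N]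
    {f : CuspForm (Gamma0 N) 2} (hf : IsNewformOf W f) (c : ℚ_[2]) :
    ‖constantCoeff (C c * padicLFunction f (unitRoot W 2 : ℚ_[2]))‖ =
      ‖c * (ratPlusSymbol f 0 : ℚ_[2])‖ * ‖((W.reductionPointCount 2 : ℕ) : ℚ_[2])‖ ^ 2 := by
  obtain ⟨u, hu⟩ := exists_unit_one_sub_unitRoot_inv 2 W hord
  have hun : ‖((u : ℤ_[2]) : ℚ_[2])‖ = 1 := by
    rw [PadicInt.padic_norm_e_of_padicInt]; exact PadicInt.isUnit_iff.mp u.isUnit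
  rw [map_mul, constantCoeff_C, constantCoeff_padicLFunction_unitRoot hord hf, hu]
  simp only [norm_mul, norm_pow, hun, one_mul]
  ring

/-- **Hence `‖[T⁰](c·L₂(f,α))‖ ≤ ¼·‖c·[0]⁺_f‖`: two extra powers of `2` in the constant term, at EVERY good ordinary `2`.**
[cite: Mazur1972, §7] [cite: MazurTateTeitelbaum1986Invent, §I.14 (14.3)] -/
theorem norm_constantCoeff_C_mul_padicLFunction_two_le (hord : IsOrdinaryAt W 2) {N : ℕ} [NeZero N]
    {f : CuspForm (Gamma0 N) 2} (hf : IsNewformOf W f) (c : ℚ_[2]) :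
    ‖constantCoeff (C c * padicLFunction f (unitRoot W 2 : ℚ_[2]))‖ ≤ 4⁻¹ * ‖c * (ratPlusSymbol f 0 : ℚ_[2])‖ := by
  rw [norm_constantCoeff_C_mul_padicLFunction_two hord hf c]
  have h := norm_reductionPointCount_two_le_half (W := W) hord
  have h0 : 0 ≤ ‖((W.reductionPointCount 2 : ℕ) : ℚ_[2])‖ := norm_nonneg _
  have hsq : ‖((W.reductionPointCount 2 : ℕ) : ℚ_[2])‖ ^ 2 ≤ 4⁻¹ := by nlinarith
  have hc : 0 ≤ ‖c * (ratPlusSymbol f 0 : ℚ_[2])‖ := norm_nonneg _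
  nlinarith

variable [NeZero (W.conductorNorm ℤ)] {f : CuspForm (Gamma0 (W.conductorNorm ℤ)) 2}

/-- The functional equation of `c·L₂(f,α)` (conductor level) with exponent: `(cL)(T^ι) = w_E (1+T)^s (cL)(T)`.
[cite: GreenbergLNM1716, §1 (functional equation and ⟨N_E⟩, pp. 67–68)] -/
theorem exists_subst_C_mul_padicLFunction_two_eq (hord : IsOrdinaryAt W 2) (hf : IsNewformOf W f) (c : ℚ_[2]) :
    ∃ s : ℤ_[2], (C c * padicLFunction f (unitRoot W 2 : ℚ_[2])).subst (invOnePlusSubOne : ℚ_[2]⟦X⟧) =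
      C ((W.rootNumber : ℤ) : ℚ_[2]) * binomialSeries ℚ_[2] s * (C c * padicLFunction f (unitRoot W 2 : ℚ_[2])) := by
  obtain ⟨-, s, -, hFE⟩ := exists_exponent_subst_padicLFunction_eq_conductorLevel (p := 2) hord hf
  refine ⟨s, ?_⟩
  rw [← smul_eq_C_mul, subst_smul hasSubst_invOnePlusSubOne c _, hFE, smul_eq_C_mul, smul_eq_C_mul]
  ring

/-- **Root number `−1`: the constant term of `L₂(f,α)` vanishes** (so `[0]⁺_f = 0`, `L(E,1) = 0`).
[cite: GreenbergLNM1716, §1 (functional equation, pp. 67–68)] -/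
theorem constantCoeff_C_mul_padicLFunction_two_eq_zero_of_rootNumber_eq_neg_one (hord : IsOrdinaryAt W 2)
    (hf : IsNewformOf W f) (hw : W.rootNumber = -1) (c : ℚ_[2]) :
    constantCoeff (C c * padicLFunction f (unitRoot W 2 : ℚ_[2])) = 0 := by
  obtain ⟨s, hFE⟩ := exists_subst_C_mul_padicLFunction_two_eq hord hf c
  rw [hw] at hFE
  push_cast at hFE
  exact constantCoeff_eq_zero_of_subst_invOnePlusSubOne_eq_neg hFE

/-- **Root number `+1`: the first-order coefficient inherits a power of `2` from the anomalous constant term**: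
`‖[T¹](c·L₂(f,α))‖ ≤ 2·‖[T⁰](c·L₂(f,α))‖ ≤ ½·‖c·[0]⁺_f‖`. [cite: GreenbergLNM1716, §1 (pp. 67–68) and §5 p. 181] -/
theorem norm_coeff_one_le_two_mul_norm_constantCoeff_two (hord : IsOrdinaryAt W 2) (hf : IsNewformOf W f)
    (hw : W.rootNumber = 1) (c : ℚ_[2]) :
    ‖coeff 1 (C c * padicLFunction f (unitRoot W 2 : ℚ_[2]))‖ ≤
      2 * ‖constantCoeff (C c * padicLFunction f (unitRoot W 2 : ℚ_[2]))‖ := by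
  obtain ⟨s, hFE⟩ := exists_subst_C_mul_padicLFunction_two_eq hord hf c
  rw [hw] at hFE
  push_cast at hFE
  exact norm_coeff_one_le_of_subst_invOnePlusSubOne_eq hFE

/-- Root number `+1` and `[0]⁺_f = 0` (`L(E,1) = 0`, analytic rank even `≥ 2`): `[T¹](c·L₂(f,α)) = 0` too, i.e. `T² ∣ L₂(f,α)`.
[cite: GreenbergLNM1716, §1 (pp. 67–68) and §5 p. 181] -/
theorem coeff_one_C_mul_padicLFunction_two_eq_zero_of_rootNumber_eq_one (hord : IsOrdinaryAt W 2) (hf : IsNewformOf W f)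
    (hw : W.rootNumber = 1) (h0 : ratPlusSymbol f 0 = 0) (c : ℚ_[2]) :
    coeff 1 (C c * padicLFunction f (unitRoot W 2 : ℚ_[2])) = 0 := by
  have h := norm_coeff_one_le_two_mul_norm_constantCoeff_two hord hf hw c
  have hG0 : constantCoeff (C c * padicLFunction f (unitRoot W 2 : ℚ_[2])) = 0 := by
    rw [← coeff_zero_eq_constantCoeff_apply, coeff_C_mul, coeff_zero_eq_constantCoeff_apply,
      constantCoeff_padicLFunction_unitRoot hord hf, h0, Rat.cast_zero, mul_zero, mul_zero]
  rw [hG0, norm_zero, mul_zero] at h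
  exact norm_le_zero_iff.mp h

end Curve

/-! ## §3 The analytic anomalous floor for `λ` -/

section Floor

variable {W : WeierstrassCurve ℚ} [W.IsElliptic] [W.IsGloballyMinimal] [NeZero (W.conductorNorm ℤ)]
  {f : CuspForm (Gamma0 (W.conductorNorm ℤ)) 2}

/-- The `2`-free part of an integral multiple: if `ι L₀ = c·L` then `ι (pfree L₀) = (2^{μ(L₀)})⁻¹ c · L` and the coefficients of
`(2^{μ})⁻¹ c · L` are those of `pfree L₀`. [cite: Washington1997, §7.1] -/
theorem coeff_pfree_scalar_eq {c : ℚ_[2]} {L₀ : IwasawaAlgebra 2} {L : ℚ_[2]⟦X⟧}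
    (hL₀ : iwasawaToPowerSeries 2 L₀ = C c * L) (k : ℕ) :
    coeff k (C (((2 : ℚ_[2]) ^ mu L₀)⁻¹ * c) * L) = ((coeff k (pfree L₀) : ℤ_[2]) : ℚ_[2]) := by
  have h2μ : ((2 : ℚ_[2]) ^ mu L₀) ≠ 0 := pow_ne_zero _ (by norm_num)
  have hιC : ∀ x : ℤ_[2], iwasawaToPowerSeries 2 (PowerSeries.C x) = PowerSeries.C (x : ℚ_[2]) :=
    fun x => by rw [iwasawaToPowerSeries, PowerSeries.map_C]; rfl
  have hcast : ((((2 : ℕ) : ℤ_[2]) ^ mu L₀ : ℤ_[2]) : ℚ_[2]) = (2 : ℚ_[2]) ^ mu L₀ := by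
    push_cast; rfl
  have hι : iwasawaToPowerSeries 2 L₀ = C ((2 : ℚ_[2]) ^ mu L₀) * iwasawaToPowerSeries 2 (pfree L₀) := by
    conv_lhs => rw [eq_C_pow_mu_mul_pfree L₀]
    rw [map_mul, hιC, hcast]
  have hιP : iwasawaToPowerSeries 2 (pfree L₀) = C (((2 : ℚ_[2]) ^ mu L₀)⁻¹ * c) * L := by
    have : iwasawaToPowerSeries 2 (pfree L₀) = C (((2 : ℚ_[2]) ^ mu L₀)⁻¹) * iwasawaToPowerSeries 2 L₀ := by
      rw [hι, ← mul_assoc, ← map_mul, inv_mul_cancel₀ h2μ, map_one, one_mul]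
    rw [this, hL₀, ← mul_assoc, ← map_mul]
  rw [← hιP, iwasawaToPowerSeries, PowerSeries.coeff_map]
  rfl

/-- **The floor lemma (root number `+1`).** `W` globally minimal, good ordinary at `2` (`hord`), `f` its newform (`hf`), `w_E = +1`
(`hw`), `L₀ ∈ Λ` nonzero with `ι L₀ = c·L₂(f,α)`. If `λ(L₀) ≤ 1` then `½ ≤ 2^{μ(L₀)}·‖c·[0]⁺_f‖·‖#Ẽ(𝔽₂)‖²`. Proof: the first
unit coefficient of `P = pfree L₀` sits at index `λ ≤ 1`; `‖P₁‖ ≤ 2‖P₀‖` (functional equation at order one), so `‖P₀‖ ≥ ½`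
either way; and `‖P₀‖ = 2^μ‖c[0]⁺‖‖#Ẽ‖²` (anomalous constant term). [cite: GreenbergLNM1716, §5 p. 181] [cite: Mazur1972, §7] -/
theorem half_le_of_lam_le_one_of_rootNumber_eq_one (hord : IsOrdinaryAt W 2) (hf : IsNewformOf W f)
    (hw : W.rootNumber = 1) {c : ℚ_[2]} {L₀ : IwasawaAlgebra 2} (hL₀0 : L₀ ≠ 0)
    (hL₀ : iwasawaToPowerSeries 2 L₀ = C c * padicLFunction f (unitRoot W 2 : ℚ_[2])) (hlam : lam L₀ ≤ 1) :
    (2 : ℝ)⁻¹ ≤ (2 : ℝ) ^ mu L₀ * ‖c * (ratPlusSymbol f 0 : ℚ_[2])‖ * ‖((W.reductionPointCount 2 : ℕ) : ℚ_[2])‖ ^ 2 := by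
  set t : ℚ_[2] := ((2 : ℚ_[2]) ^ mu L₀)⁻¹ * c with ht
  set G : ℚ_[2]⟦X⟧ := C t * padicLFunction f (unitRoot W 2 : ℚ_[2]) with hG
  have hcoeff : ∀ k, coeff k G = ((coeff k (pfree L₀) : ℤ_[2]) : ℚ_[2]) := fun k => coeff_pfree_scalar_eq hL₀ k
  -- `‖G₀‖ = 2^μ ‖c [0]⁺‖ ‖#Ẽ‖²`
  have hG0 : ‖constantCoeff G‖ =
      (2 : ℝ) ^ mu L₀ * ‖c * (ratPlusSymbol f 0 : ℚ_[2])‖ * ‖((W.reductionPointCount 2 : ℕ) : ℚ_[2])‖ ^ 2 := by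
    rw [hG, norm_constantCoeff_C_mul_padicLFunction_two hord hf t, ht, mul_assoc (((2 : ℚ_[2]) ^ mu L₀)⁻¹), norm_mul,
      anomalousFloor_norm_inv_two_pow]
  -- `‖G₁‖ ≤ 2 ‖G₀‖`
  have hG1 : ‖coeff 1 G‖ ≤ 2 * ‖constantCoeff G‖ := norm_coeff_one_le_two_mul_norm_constantCoeff_two hord hf hw t
  rw [← hG0]
  -- the first unit coefficient of `pfree L₀` is at `λ ≤ 1`
  have hunit : ‖coeff (lam L₀) G‖ = 1 := by rw [hcoeff]; exact norm_coeff_pfree_lam hL₀0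
  rcases Nat.le_one_iff_eq_zero_or_eq_one.mp hlam with h0 | h1
  · rw [h0, coeff_zero_eq_constantCoeff] at hunit
    rw [hunit]; norm_num
  · rw [h1] at hunit
    rw [hunit] at hG1
    linarith

/-- **THE ANALYTIC ANOMALOUS FLOOR.** `W` globally minimal, good ordinary at `2`, `f` its newform, root number `+1`; `L₀ ∈ Λ` nonzero,
`ι L₀ = c·L₂(f,α)`. If the normalised `L`-value is `μ`-integral — `‖c·[0]⁺_f‖₂ ≤ 2^{−μ(L₀)}`, i.e. `v₂(c·L(E,1)/Ω⁺_f) ≥ μ(L₀)`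
(scale-free in `(c, L₀)`) — then **`λ(L₀) ≥ 2`**. (`2^μ·‖c[0]⁺‖·‖#Ẽ(𝔽₂)‖² ≤ ¼ < ½`.) GEN 8's law L3 on the analytic side.
[cite: Mazur1972, §7] [cite: GreenbergLNM1716, §5 p. 181] -/
theorem two_le_lam_of_rootNumber_eq_one_of_norm_le (hord : IsOrdinaryAt W 2) (hf : IsNewformOf W f)
    (hw : W.rootNumber = 1) {c : ℚ_[2]} {L₀ : IwasawaAlgebra 2} (hL₀0 : L₀ ≠ 0)
    (hL₀ : iwasawaToPowerSeries 2 L₀ = C c * padicLFunction f (unitRoot W 2 : ℚ_[2]))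
    (hval : ‖c * (ratPlusSymbol f 0 : ℚ_[2])‖ ≤ ((2 : ℝ) ^ mu L₀)⁻¹) : 2 ≤ lam L₀ := by
  by_contra hlt
  have h := half_le_of_lam_le_one_of_rootNumber_eq_one hord hf hw hL₀0 hL₀ (by omega)
  have hE := norm_reductionPointCount_two_le_half (W := W) hord
  have hE0 : 0 ≤ ‖((W.reductionPointCount 2 : ℕ) : ℚ_[2])‖ := norm_nonneg _
  have hsq : ‖((W.reductionPointCount 2 : ℕ) : ℚ_[2])‖ ^ 2 ≤ 4⁻¹ := by nlinarith
  have h2μ : (0 : ℝ) < (2 : ℝ) ^ mu L₀ := by positivity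
  have h1 : (2 : ℝ) ^ mu L₀ * ‖c * (ratPlusSymbol f 0 : ℚ_[2])‖ ≤ 1 := by
    calc (2 : ℝ) ^ mu L₀ * ‖c * (ratPlusSymbol f 0 : ℚ_[2])‖ ≤ (2 : ℝ) ^ mu L₀ * ((2 : ℝ) ^ mu L₀)⁻¹ :=
          mul_le_mul_of_nonneg_left hval h2μ.le
      _ = 1 := mul_inv_cancel₀ h2μ.ne'
  have hc0 : 0 ≤ (2 : ℝ) ^ mu L₀ * ‖c * (ratPlusSymbol f 0 : ℚ_[2])‖ := by positivity
  nlinarith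

/-- **`μ = 0` form**: root number `+1`, `μ(L₀) = 0` and `c·[0]⁺_f ∈ ℤ₂` (`‖c·[0]⁺_f‖ ≤ 1`) ⟹ `λ(L₀) ≥ 2` — «`μ_an = 0` and a
`2`-integral normalised `L`-value give `λ_an ≥ 2`». [cite: Mazur1972, §7] [cite: GreenbergLNM1716, §5 p. 181] -/
theorem two_le_lam_of_mu_eq_zero_of_norm_le_one (hord : IsOrdinaryAt W 2) (hf : IsNewformOf W f)
    (hw : W.rootNumber = 1) {c : ℚ_[2]} {L₀ : IwasawaAlgebra 2} (hL₀0 : L₀ ≠ 0)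
    (hL₀ : iwasawaToPowerSeries 2 L₀ = C c * padicLFunction f (unitRoot W 2 : ℚ_[2]))
    (hμ : mu L₀ = 0) (hval : ‖c * (ratPlusSymbol f 0 : ℚ_[2])‖ ≤ 1) : 2 ≤ lam L₀ :=
  two_le_lam_of_rootNumber_eq_one_of_norm_le hord hf hw hL₀0 hL₀ (by rw [hμ, pow_zero, inv_one]; exact hval)

/-- **Root number `+1`, `[0]⁺_f = 0`** (`L(E,1) = 0`: even analytic rank `≥ 2`): `λ(L₀) ≥ 2` for every nonzero integral multiple
`L₀` of `L₂(f,α)` — both `[T⁰]` and `[T¹]` of `ι(pfree L₀)` vanish. [cite: GreenbergLNM1716, §1 (pp. 67–68) and §5 p. 181] -/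
theorem two_le_lam_of_rootNumber_eq_one_of_ratPlusSymbol_eq_zero (hord : IsOrdinaryAt W 2) (hf : IsNewformOf W f)
    (hw : W.rootNumber = 1) (h0 : ratPlusSymbol f 0 = 0) {c : ℚ_[2]} {L₀ : IwasawaAlgebra 2} (hL₀0 : L₀ ≠ 0)
    (hL₀ : iwasawaToPowerSeries 2 L₀ = C c * padicLFunction f (unitRoot W 2 : ℚ_[2])) : 2 ≤ lam L₀ := by
  set t : ℚ_[2] := ((2 : ℚ_[2]) ^ mu L₀)⁻¹ * c with ht
  have hcoeff : ∀ k, coeff k (C t * padicLFunction f (unitRoot W 2 : ℚ_[2])) =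
      ((coeff k (pfree L₀) : ℤ_[2]) : ℚ_[2]) := fun k => coeff_pfree_scalar_eq hL₀ k
  have hunit : ‖coeff (lam L₀) (C t * padicLFunction f (unitRoot W 2 : ℚ_[2]))‖ = 1 := by
    rw [hcoeff]; exact norm_coeff_pfree_lam hL₀0
  have hG0 : constantCoeff (C t * padicLFunction f (unitRoot W 2 : ℚ_[2])) = 0 := by
    rw [← coeff_zero_eq_constantCoeff_apply, coeff_C_mul, coeff_zero_eq_constantCoeff_apply,
      constantCoeff_padicLFunction_unitRoot hord hf, h0, Rat.cast_zero, mul_zero, mul_zero]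
  have hG1 : coeff 1 (C t * padicLFunction f (unitRoot W 2 : ℚ_[2])) = 0 :=
    coeff_one_C_mul_padicLFunction_two_eq_zero_of_rootNumber_eq_one hord hf hw h0 t
  by_contra hlt
  rcases Nat.le_one_iff_eq_zero_or_eq_one.mp (by omega : lam L₀ ≤ 1) with h | h
  · rw [h, coeff_zero_eq_constantCoeff, hG0, norm_zero] at hunit; exact zero_ne_one hunit
  · rw [h, hG1, norm_zero] at hunit; exact zero_ne_one hunit

/-- **Root number `−1`: `λ(L₀) ≥ 1`** for every nonzero integral multiple of `L₂(f,α)` (`[T⁰]` vanishes).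
[cite: GreenbergLNM1716, §1 (functional equation, pp. 67–68)] -/
theorem one_le_lam_of_rootNumber_eq_neg_one (hord : IsOrdinaryAt W 2) (hf : IsNewformOf W f)
    (hw : W.rootNumber = -1) {c : ℚ_[2]} {L₀ : IwasawaAlgebra 2} (hL₀0 : L₀ ≠ 0)
    (hL₀ : iwasawaToPowerSeries 2 L₀ = C c * padicLFunction f (unitRoot W 2 : ℚ_[2])) : 1 ≤ lam L₀ := by
  set t : ℚ_[2] := ((2 : ℚ_[2]) ^ mu L₀)⁻¹ * c with ht
  have hcoeff : ∀ k, coeff k (C t * padicLFunction f (unitRoot W 2 : ℚ_[2])) =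
      ((coeff k (pfree L₀) : ℤ_[2]) : ℚ_[2]) := fun k => coeff_pfree_scalar_eq hL₀ k
  have hunit : ‖coeff (lam L₀) (C t * padicLFunction f (unitRoot W 2 : ℚ_[2]))‖ = 1 := by
    rw [hcoeff]; exact norm_coeff_pfree_lam hL₀0
  have hG0 : constantCoeff (C t * padicLFunction f (unitRoot W 2 : ℚ_[2])) = 0 :=
    constantCoeff_C_mul_padicLFunction_two_eq_zero_of_rootNumber_eq_neg_one hord hf hw t
  by_contra hlt
  have h : lam L₀ = 0 := by omega
  rw [h, coeff_zero_eq_constantCoeff, hG0, norm_zero] at hunit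
  exact zero_ne_one hunit

end Floor

end Summit.BirchSwinnertonDyer.BirchSwinnertonDyer.Theorems.TwoAdicTwistConverse

end
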